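import Mathlib
import Summits.Ventures.PercRepro2.Defs
import Summits.Ventures.PercRepro2.Graph
import Summits.Ventures.PercRepro2.Induced
import Summits.Ventures.PercRepro2.VdBKahn
import Summits.Ventures.PercRepro2.ReimerVdBK
import Summits.Ventures.PercRepro2.ReimerVdBKRegions
import Summits.Ventures.PercRepro2.ReimerVdBKZClosed
import Summits.Ventures.PercRepro2.ReimerVdBKZReduction
import Summits.Ventures.PercRepro2.ReimerVdBKZSplit
import Summits.Ventures.PercRepro2.ReimerVdBKZRecursion
import Summits.Ventures.PercRepro2.ReimerVdBKTypeWeight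
import Summits.Ventures.PercRepro2.ReimerVdBKPairType
import Summits.Ventures.PercRepro2.ReimerVdBKCoreDown
import Summits.Ventures.PercRepro2.ReimerVdBKCoreD
import Summits.Ventures.PercRepro2.ReimerVdBKDegTwoGraph

/-!
# The degree-3 expansion, I: the graphs `G⁺_k` and their clusters
(blind cell PercRepro2, mine-c g47; `conjectures/MINE-C.md` §56.7 (b))

Let `v ≠ s` be a vertex whose only edges are `e₁ = {v, u₁}`, `e₂ = {v, u₂}`, `e₃ = {v, u₃}` (`Deg3`).  For the colour
class «`e₁, e₂` of one colour, `e₃` of the other» the graph `G⁺` (`endsP3`) replaces the pair by the edge `u₁u₂` (on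
`e₁`; `e₂`, `e₃` become loops).  THEOREMS: with `e₁, e₂` open and `e₃` closed the clusters of `G` and `G⁺` agree
off `v` and `v` is reached iff `u₁` is (`conn_iff_endsP3_merge`); with `e₁, e₂` closed and `e₃` open they agree off
`v` and `v` is reached iff `u₃` is (`conn_iff_endsP3_leaf`).  The other two classes are the same statements for the
permuted star (`Deg3.rot`).
-/

namespace Summit.Ventures.PercRepro2
namespace ReimerVdBK
open Classical

variable {V : Type*} {E : Type*} [Fintype E] [DecidableEq E] [Fintype V] [DecidableEq V]
variable (ends : E → Sym2 V) (s : V)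

omit [Fintype E] [DecidableEq E] [Fintype V] [DecidableEq V] in
/-- `v` has exactly the three edges `e₁ = {v, u₁}`, `e₂ = {v, u₂}`, `e₃ = {v, u₃}` (`u_i ≠ v`). -/
structure Deg3 (v u₁ u₂ u₃ : V) (e₁ e₂ e₃ : E) : Prop where
  ne12 : e₁ ≠ e₂
  ne13 : e₁ ≠ e₃
  ne23 : e₂ ≠ e₃
  h1 : ends e₁ = s(v, u₁)
  h2 : ends e₂ = s(v, u₂)
  h3 : ends e₃ = s(v, u₃)
  hu1 : u₁ ≠ v
  hu2 : u₂ ≠ v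
  hu3 : u₃ ≠ v
  other : ∀ e, e ≠ e₁ → e ≠ e₂ → e ≠ e₃ → v ∉ ends e

/-- `G⁺` for the class «`e₁, e₂` | `e₃`»: `e₁` becomes `u₁u₂`, `e₂` and `e₃` loops at `v`. -/
def endsP3 (v u₁ u₂ : V) (e₁ e₂ e₃ : E) : E → Sym2 V :=
  Function.update (Function.update (Function.update ends e₁ s(u₁, u₂)) e₂ s(v, v)) e₃ s(v, v)

section Lemmas
variable {v u₁ u₂ u₃ : V} {e₁ e₂ e₃ : E}

omit [Fintype E] [DecidableEq E] [Fintype V] [DecidableEq V] in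
/-- The star rotated: `(e₂, e₃, e₁)`. -/
lemma Deg3.rot (hd : Deg3 ends v u₁ u₂ u₃ e₁ e₂ e₃) : Deg3 ends v u₂ u₃ u₁ e₂ e₃ e₁ :=
  ⟨hd.ne23, hd.ne12.symm, hd.ne13.symm, hd.h2, hd.h3, hd.h1, hd.hu2, hd.hu3, hd.hu1,
    fun e h2 h3 h1 => hd.other e h1 h2 h3⟩

omit [Fintype E] [Fintype V] [DecidableEq V] in
/-- `e₁` in `G⁺`. -/
lemma endsP3_e₁ (h12 : e₁ ≠ e₂) (h13 : e₁ ≠ e₃) : endsP3 ends v u₁ u₂ e₁ e₂ e₃ e₁ = s(u₁, u₂) := by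
  simp [endsP3, Function.update_of_ne h12, Function.update_of_ne h13]

omit [Fintype E] [Fintype V] [DecidableEq V] in
/-- `e₂` in `G⁺`. -/
lemma endsP3_e₂ (h23 : e₂ ≠ e₃) : endsP3 ends v u₁ u₂ e₁ e₂ e₃ e₂ = s(v, v) := by
  simp [endsP3, Function.update_of_ne h23]

omit [Fintype E] [Fintype V] [DecidableEq V] in
/-- `e₃` in `G⁺`. -/
lemma endsP3_e₃ : endsP3 ends v u₁ u₂ e₁ e₂ e₃ e₃ = s(v, v) := by
  simp [endsP3]

omit [Fintype E] [Fintype V] [DecidableEq V] in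
/-- Every other edge is unchanged. -/
lemma endsP3_other {e : E} (h1 : e ≠ e₁) (h2 : e ≠ e₂) (h3 : e ≠ e₃) :
    endsP3 ends v u₁ u₂ e₁ e₂ e₃ e = ends e := by
  simp [endsP3, Function.update_of_ne h1, Function.update_of_ne h2, Function.update_of_ne h3]

omit [Fintype E] [Fintype V] [DecidableEq V] in
/-- `v` is isolated in `G⁺`. -/
lemma not_conn_endsP3 (hd : Deg3 ends v u₁ u₂ u₃ e₁ e₂ e₃) (hsv : s ≠ v) (ω : Config E) :
    ¬ Conn (endsP3 ends v u₁ u₂ e₁ e₂ e₃) ω s v := by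
  apply not_conn_of_isolated s _ hsv
  intro e hve
  by_cases h1 : e = e₁
  · subst h1
    rw [endsP3_e₁ ends hd.ne12 hd.ne13] at hve ⊢
    rcases Sym2.mem_iff.1 hve with h | h
    · exact absurd h.symm hd.hu1
    · exact absurd h.symm hd.hu2
  by_cases h2 : e = e₂
  · subst h2; rw [endsP3_e₂ ends hd.ne23]; exact Sym2.mk_isDiag_iff.2 rfl
  by_cases h3 : e = e₃
  · subst h3; rw [endsP3_e₃]; exact Sym2.mk_isDiag_iff.2 rfl
  rw [endsP3_other ends h1 h2 h3] at hve
  exact absurd hve (hd.other e h1 h2 h3)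

omit [Fintype E] [DecidableEq E] [Fintype V] [DecidableEq V] in
/-- With all three star edges closed, `v` is not reached. -/
lemma not_conn_of_star3_closed (hd : Deg3 ends v u₁ u₂ u₃ e₁ e₂ e₃) (hsv : s ≠ v) {ω : Config E}
    (h1 : ω e₁ = false) (h2 : ω e₂ = false) (h3 : ω e₃ = false) : ¬ Conn ends ω s v := by
  intro h
  let S : Set V := {x | x ≠ v}
  have hS : ∀ x ∈ S, ∀ y, (openGraph ends ω).Adj x y → y ∈ S := by
    intro x hx y hxy hyv
    obtain ⟨hne, e, he, hends⟩ := openGraph_adj.1 hxy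
    subst hyv
    by_cases he1 : e = e₁
    · rw [he1, h1] at he; exact Bool.false_ne_true he
    by_cases he2 : e = e₂
    · rw [he2, h2] at he; exact Bool.false_ne_true he
    by_cases he3 : e = e₃
    · rw [he3, h3] at he; exact Bool.false_ne_true he
    · exact hd.other e he1 he2 he3 (by rw [hends]; exact Sym2.mem_mk_right _ _)
  exact mem_of_conn_of_closed hS hsv h rfl

omit [Fintype E] [Fintype V] [DecidableEq V] in
/-- **`e₁, e₂` open, `e₃` closed** (the merge pattern): for `w ≠ v`, `s ↔ w` in `G` iff in `G⁺`, and `s ↔ v`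
in `G` iff `s ↔ u₁` in `G⁺`. -/
theorem conn_iff_endsP3_merge (hd : Deg3 ends v u₁ u₂ u₃ e₁ e₂ e₃) (hsv : s ≠ v) {ω : Config E}
    (h1 : ω e₁ = true) (h2 : ω e₂ = true) (h3 : ω e₃ = false) :
    (∀ w, w ≠ v → (Conn ends ω s w ↔ Conn (endsP3 ends v u₁ u₂ e₁ e₂ e₃) ω s w)) ∧
      (Conn ends ω s v ↔ Conn (endsP3 ends v u₁ u₂ e₁ e₂ e₃) ω s u₁) := by
  set ends' := endsP3 ends v u₁ u₂ e₁ e₂ e₃ with hends'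
  have hadj : OpenAdj ends' ω u₁ u₂ := ⟨e₁, h1, by rw [hends', endsP3_e₁ ends hd.ne12 hd.ne13]⟩
  -- the `G`-cluster sits inside the `G⁺`-cluster plus `v` when `u₁` is reached
  let S : Set V := {x | Conn ends' ω s x ∨ (x = v ∧ Conn ends' ω s u₁)}
  have hS : ∀ x ∈ S, ∀ y, (openGraph ends ω).Adj x y → y ∈ S := by
    intro x hx y hxy
    obtain ⟨hne, e, he, hends⟩ := openGraph_adj.1 hxy
    by_cases he1 : e = e₁
    · rw [he1, hd.h1] at hends
      rcases eq_of_ends_eq hends with ⟨hx1, hy1⟩ | ⟨hx1, hy1⟩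
      · subst hx1; subst hy1
        rcases hx with hx | ⟨_, hu⟩
        · exact absurd hx (not_conn_endsP3 ends s hd hsv ω)
        · exact Or.inl hu
      · subst hx1; subst hy1
        rcases hx with hx | ⟨hxv, _⟩
        · exact Or.inr ⟨rfl, hx⟩
        · exact absurd hxv hd.hu1
    by_cases he2 : e = e₂
    · rw [he2, hd.h2] at hends
      rcases eq_of_ends_eq hends with ⟨hx1, hy1⟩ | ⟨hx1, hy1⟩
      · subst hx1; subst hy1
        rcases hx with hx | ⟨_, hu⟩
        · exact absurd hx (not_conn_endsP3 ends s hd hsv ω)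
        · exact Or.inl (conn_trans hu (conn_of_openAdj hadj))
      · subst hx1; subst hy1
        rcases hx with hx | ⟨hxv, _⟩
        · exact Or.inr ⟨rfl, conn_trans hx (conn_of_openAdj hadj.symm)⟩
        · exact absurd hxv hd.hu2
    by_cases he3 : e = e₃
    · rw [he3, h3] at he
      exact absurd he Bool.false_ne_true
    · have hends2 : ends' e = ends e := endsP3_other ends he1 he2 he3
      rcases hx with hx | ⟨hxv, _⟩
      · exact Or.inl (conn_trans hx (conn_of_openAdj ⟨e, he, by rw [hends2, hends]⟩))
      · subst hxv
        exact absurd (by rw [hends]; exact Sym2.mem_mk_left _ _) (hd.other e he1 he2 he3)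
  have hs : s ∈ S := Or.inl (conn_refl _ _ _)
  -- the `G⁺`-cluster sits inside the `G`-cluster
  have hsub : ∀ w, Conn ends' ω s w → Conn ends ω s w := by
    intro w hw
    let T : Set V := {x | Conn ends ω s x}
    have hT : ∀ x ∈ T, ∀ y, (openGraph ends' ω).Adj x y → y ∈ T := by
      intro x hx y hxy
      obtain ⟨hne, e, he, hends⟩ := openGraph_adj.1 hxy
      by_cases he1 : e = e₁
      · rw [he1] at hends
        rw [hends', endsP3_e₁ ends hd.ne12 hd.ne13] at hends
        have ha1 : OpenAdj ends ω v u₁ := ⟨e₁, h1, hd.h1⟩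
        have ha2 : OpenAdj ends ω v u₂ := ⟨e₂, h2, hd.h2⟩
        rcases eq_of_ends_eq hends with ⟨hx1, hy1⟩ | ⟨hx1, hy1⟩
        · subst hx1; subst hy1
          exact conn_trans (conn_trans hx (conn_of_openAdj ha1.symm)) (conn_of_openAdj ha2)
        · subst hx1; subst hy1
          exact conn_trans (conn_trans hx (conn_of_openAdj ha2.symm)) (conn_of_openAdj ha1)
      by_cases he2 : e = e₂
      · rw [he2] at hends
        rw [hends', endsP3_e₂ ends hd.ne23] at hends
        exact absurd (eq_of_loop hends) hne
      by_cases he3 : e = e₃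
      · rw [he3] at hends
        rw [hends', endsP3_e₃] at hends
        exact absurd (eq_of_loop hends) hne
      · have hends2 : ends' e = ends e := endsP3_other ends he1 he2 he3
        rw [hends2] at hends
        exact conn_trans hx (conn_of_openAdj ⟨e, he, hends⟩)
    exact mem_of_conn_of_closed hT (conn_refl _ _ _) hw
  refine ⟨fun w hw => ⟨fun h => ?_, hsub w⟩, ⟨fun h => ?_, fun h => ?_⟩⟩
  · rcases mem_of_conn_of_closed hS hs h with hw' | ⟨hwv, _⟩
    · exact hw'
    · exact absurd hwv hw
  · rcases mem_of_conn_of_closed hS hs h with hv' | ⟨_, hu⟩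
    · exact absurd hv' (not_conn_endsP3 ends s hd hsv ω)
    · exact hu
  · exact conn_trans (hsub u₁ h) (conn_of_openAdj ⟨e₁, h1, by rw [hd.h1, Sym2.eq_swap]⟩)

omit [Fintype E] [Fintype V] [DecidableEq V] in
/-- **`e₁, e₂` closed, `e₃` open** (the leaf pattern): for `w ≠ v`, `s ↔ w` in `G` iff in `G⁺`, and `s ↔ v`
in `G` iff `s ↔ u₃` in `G⁺`. -/
theorem conn_iff_endsP3_leaf (hd : Deg3 ends v u₁ u₂ u₃ e₁ e₂ e₃) (hsv : s ≠ v) {ω : Config E}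
    (h1 : ω e₁ = false) (h2 : ω e₂ = false) (h3 : ω e₃ = true) :
    (∀ w, w ≠ v → (Conn ends ω s w ↔ Conn (endsP3 ends v u₁ u₂ e₁ e₂ e₃) ω s w)) ∧
      (Conn ends ω s v ↔ Conn (endsP3 ends v u₁ u₂ e₁ e₂ e₃) ω s u₃) := by
  set ends' := endsP3 ends v u₁ u₂ e₁ e₂ e₃ with hends'
  let S : Set V := {x | Conn ends' ω s x ∨ (x = v ∧ Conn ends' ω s u₃)}
  have hS : ∀ x ∈ S, ∀ y, (openGraph ends ω).Adj x y → y ∈ S := by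
    intro x hx y hxy
    obtain ⟨hne, e, he, hends⟩ := openGraph_adj.1 hxy
    by_cases he1 : e = e₁
    · rw [he1, h1] at he; exact absurd he Bool.false_ne_true
    by_cases he2 : e = e₂
    · rw [he2, h2] at he; exact absurd he Bool.false_ne_true
    by_cases he3 : e = e₃
    · rw [he3, hd.h3] at hends
      rcases eq_of_ends_eq hends with ⟨hx1, hy1⟩ | ⟨hx1, hy1⟩
      · subst hx1; subst hy1
        rcases hx with hx | ⟨_, hu⟩
        · exact absurd hx (not_conn_endsP3 ends s hd hsv ω)
        · exact Or.inl hu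
      · subst hx1; subst hy1
        rcases hx with hx | ⟨hxv, _⟩
        · exact Or.inr ⟨rfl, hx⟩
        · exact absurd hxv hd.hu3
    · have hends2 : ends' e = ends e := endsP3_other ends he1 he2 he3
      rcases hx with hx | ⟨hxv, _⟩
      · exact Or.inl (conn_trans hx (conn_of_openAdj ⟨e, he, by rw [hends2, hends]⟩))
      · subst hxv
        exact absurd (by rw [hends]; exact Sym2.mem_mk_left _ _) (hd.other e he1 he2 he3)
  have hs : s ∈ S := Or.inl (conn_refl _ _ _)
  have hsub : ∀ w, Conn ends' ω s w → Conn ends ω s w := by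
    intro w hw
    let T : Set V := {x | Conn ends ω s x}
    have hT : ∀ x ∈ T, ∀ y, (openGraph ends' ω).Adj x y → y ∈ T := by
      intro x hx y hxy
      obtain ⟨hne, e, he, hends⟩ := openGraph_adj.1 hxy
      by_cases he1 : e = e₁
      · rw [he1, h1] at he; exact absurd he Bool.false_ne_true
      by_cases he2 : e = e₂
      · rw [he2] at hends
        rw [hends', endsP3_e₂ ends hd.ne23] at hends
        exact absurd (eq_of_loop hends) hne
      by_cases he3 : e = e₃
      · rw [he3] at hends
        rw [hends', endsP3_e₃] at hends
        exact absurd (eq_of_loop hends) hne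
      · have hends2 : ends' e = ends e := endsP3_other ends he1 he2 he3
        rw [hends2] at hends
        exact conn_trans hx (conn_of_openAdj ⟨e, he, hends⟩)
    exact mem_of_conn_of_closed hT (conn_refl _ _ _) hw
  refine ⟨fun w hw => ⟨fun h => ?_, hsub w⟩, ⟨fun h => ?_, fun h => ?_⟩⟩
  · rcases mem_of_conn_of_closed hS hs h with hw' | ⟨hwv, _⟩
    · exact hw'
    · exact absurd hwv hw
  · rcases mem_of_conn_of_closed hS hs h with hv' | ⟨_, hu⟩
    · exact absurd hv' (not_conn_endsP3 ends s hd hsv ω)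
    · exact hu
  · exact conn_trans (hsub u₃ h) (conn_of_openAdj ⟨e₃, h3, by rw [hd.h3, Sym2.eq_swap]⟩)

end Lemmas

end ReimerVdBK
end Summit.Ventures.PercRepro2
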